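import Mathlib
import HarnessLib
import Summits.HubbardSuperconductivity.HubbardSuperconductivity.Theorems.KLProgrammeKLRegimeWickLegDressingGeneric

/-!
# Route `KLProgramme` — ENGINE child (stmt-HubbardSuperconductivity-19918 / gen-6 successor), (E2-v10) leg-dress line: two-leg SELECTION for the
# PLAIN carrier `𝒱_n = klEffectiveAction … e₀ n` and the exact leg-dressing identity ON THE PLAIN CARRIERS (cell gate-hubbard-kl, seat
# hubbard-kl-k3c2-p3 g3, row «leg-dress bar»; copies p1 g9's `𝒲_n` bookkeeping of `…WickConservation` §4 / `…WickBubbleChannels` §1 onto `𝒱_n` via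
# the tree's `kernel_klEffectiveAction_eq_zero_of_weight_ne`, then instantiates `vertexFn_dblFold_oneLine_of_twoLeg`)

* §1 conservation as signed sums for `𝒱_n`: `kernel_klEffectiveAction_eq_zero_of_twoPow/_charge/_freq/_spin/_momentum`;
* §2 two-leg selection: `kernel_klEffectiveAction_two_plus_eq_zero` / `_two_minus_eq_zero`;
* §3 **`vertexFn_dblFold_oneLine_effectiveAction`**: for any diagonal line `C` (values `ℓ`) and any four legs,
  `𝒱₄(dblFold(Δ_×(C)(𝒱_n⁰·𝒱_n¹)))(Z) = 2·(βL²)⁻¹·𝒱₄(𝒱_n)(Z)·Σ_i ℓ(p_i)·klSelfEnergy … e₀ n (p_i) σ_i` — the self-energy that `RenormalisedAtF` /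
  `TwoLegSlopes` / `…SplitLegDressing` read (`e₀ = klE0`); norm form `norm_vertexFn_dblFold_oneLine_effectiveAction_le`.
Proved; no definitions; model bookkeeping only.
-/

noncomputable section

namespace Summit.HubbardSuperconductivity.HubbardSuperconductivity.Theorems.KLRegimeWick

set_option linter.dupNamespace false -- summit = problem name (single-conjunct summit), D-0017

open Literature.MathematicalPhysics.QuantumLattice GrassmannAlgebra Finset Matrix
open Literature.Probability.LatticeModels
open Summit.HubbardSuperconductivity.HubbardSuperconductivity.Theorems.TwoPointAssembly
open Summit.HubbardSuperconductivity.HubbardSuperconductivity.Theorems.KLProgrammeLegKernels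
open Summit.HubbardSuperconductivity.HubbardSuperconductivity.Theorems.KLRegimeSplit

section Model

variable {L M : ℕ} [NeZero L] [NeZero M] (β U μ : ℝ) (K : TrigPolyC4v) (e₀ : ℝ)

/-! ## §1 The four conservation laws of `𝒱_n` as signed sums -/

/-- **Selection rule for weights `2^{g}`** on `𝒱_n`: if `Σ_i ±g(Xᵢ) ≠ 0` for a vertex-additive `g`, the kernel vanishes at `X`. -/
theorem kernel_klEffectiveAction_eq_zero_of_twoPow (g : FreqMomentum L M × Fin 2 → ℤ)
    (hg : ∀ k₁ k₂ k₃ k₄ : FreqMomentum L M,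
      matsubaraInt M k₁.1 + matsubaraInt M k₃.1 = matsubaraInt M k₂.1 + matsubaraInt M k₄.1 ∧ k₁.2 + k₃.2 = k₂.2 + k₄.2 →
        g (k₁, 0) + g (k₃, 1) = g (k₂, 0) + g (k₄, 1))
    (n : ℕ) {m : ℕ} {X : Fin m → HubbardFieldIdx L M} (hX : ∑ i, (if (X i).2 = 0 then (1 : ℤ) else -1) * g (X i).1 ≠ 0) :
    kernel ℂ (klEffectiveAction L M β U μ K e₀ n) m X = 0 := by
  refine kernel_klEffectiveAction_eq_zero_of_weight_ne (fun p => (2 : ℂ) ^ g p) (fun p => zpow_ne_zero _ two_ne_zero)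
    (twoPow_compatible g hg) β U μ K e₀ n ?_
  rw [prod_scalingWeight_two_zpow]
  intro h
  exact hX (two_zpow_injective (h.trans (zpow_zero (2 : ℂ)).symm))

/-- **CHARGE conservation** for `𝒱_n`. -/
theorem kernel_klEffectiveAction_eq_zero_of_charge (n : ℕ) {m : ℕ} {X : Fin m → HubbardFieldIdx L M}
    (hX : ∑ i, (if (X i).2 = 0 then (1 : ℤ) else -1) ≠ 0) : kernel ℂ (klEffectiveAction L M β U μ K e₀ n) m X = 0 :=
  kernel_klEffectiveAction_eq_zero_of_twoPow β U μ K e₀ (fun _ => 1) (fun _ _ _ _ _ => rfl) n (by simpa using hX)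

/-- **FREQUENCY conservation** for `𝒱_n`. -/
theorem kernel_klEffectiveAction_eq_zero_of_freq (n : ℕ) {m : ℕ} {X : Fin m → HubbardFieldIdx L M}
    (hX : ∑ i, (if (X i).2 = 0 then (1 : ℤ) else -1) * matsubaraInt M (X i).1.1.1 ≠ 0) :
    kernel ℂ (klEffectiveAction L M β U μ K e₀ n) m X = 0 :=
  kernel_klEffectiveAction_eq_zero_of_twoPow β U μ K e₀ (fun p => matsubaraInt M p.1.1) (fun _ _ _ _ h => h.1) n hX

/-- **SPIN conservation** for `𝒱_n`. -/
theorem kernel_klEffectiveAction_eq_zero_of_spin (n : ℕ) {m : ℕ} {X : Fin m → HubbardFieldIdx L M}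
    (hX : ∑ i, (if (X i).2 = 0 then (1 : ℤ) else -1) * (if (X i).1.2 = 0 then 1 else 0) ≠ 0) :
    kernel ℂ (klEffectiveAction L M β U μ K e₀ n) m X = 0 :=
  kernel_klEffectiveAction_eq_zero_of_twoPow β U μ K e₀ (fun p => if p.2 = 0 then 1 else 0) (fun _ _ _ _ _ => by simp) n hX

/-- **MOMENTUM conservation** for `𝒱_n`, coordinate by coordinate. -/
theorem kernel_klEffectiveAction_eq_zero_of_momentum (n : ℕ) {m : ℕ} {X : Fin m → HubbardFieldIdx L M}
    (j : Fin 2) (hX : ∑ i, (if (X i).2 = 0 then (1 : ℤ) else -1) • (X i).1.1.2 j ≠ 0) :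
    kernel ℂ (klEffectiveAction L M β U μ K e₀ n) m X = 0 := by
  refine kernel_klEffectiveAction_eq_zero_of_weight_ne (fun p => (ZMod.stdAddChar (p.1.2 j) : ℂ)) (fun p => stdAddChar_ne_zero _)
    (fun k₁ k₂ k₃ k₄ h => ?_) β U μ K e₀ n ?_
  · rw [← AddChar.map_add_eq_mul, ← AddChar.map_add_eq_mul, ← Pi.add_apply k₁.2, ← Pi.add_apply k₂.2, h.2]
  · have hw : ∏ i, scalingWeight (fun p => (ZMod.stdAddChar (p.1.2 j) : ℂ)) (X i) =
        ZMod.stdAddChar (∑ i, (if (X i).2 = 0 then (1 : ℤ) else -1) • (X i).1.1.2 j) := by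
      rw [addChar_map_sum]
      refine Finset.prod_congr rfl fun i _ => ?_
      rw [scalingWeight_eq_zpow, AddChar.map_zsmul_eq_zpow]
    rw [hw]
    intro h
    apply hX
    exact ZMod.injective_stdAddChar (h.trans (AddChar.map_zero_eq_one _).symm)

/-! ## §2 Two-leg selection for `𝒱_n` -/

/-- **Two-leg kernels of `𝒱_n` pair only reciprocal labels** (`ψ̂⁺` first): `kernel 𝒱_n 2 (ψ̂⁺_{pσ}, Y′) = 0` unless `Y′ = ψ̂⁻_{pσ}`. -/
theorem kernel_klEffectiveAction_two_plus_eq_zero (n : ℕ) (p : FreqMomentum L M) (σ : Fin 2) {Y' : HubbardFieldIdx L M}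
    (hY : Y' ≠ ((p, σ), 1)) : kernel ℂ (klEffectiveAction L M β U μ K e₀ n) 2 ![((p, σ), 0), Y'] = 0 := by
  rcases Y' with ⟨⟨p', σ'⟩, c'⟩
  by_cases hc : c' = 1
  · subst hc
    by_cases hσ : σ' = σ
    · subst hσ
      by_cases hf : p'.1 = p.1
      · have hm : p'.2 ≠ p.2 := fun h2 => hY (by rw [show p' = p from Prod.ext hf h2])
        have : ∃ j : Fin 2, p'.2 j ≠ p.2 j := by
          by_contra hall
          push Not at hall
          exact hm (funext hall)
        obtain ⟨j, hj⟩ := this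
        refine kernel_klEffectiveAction_eq_zero_of_momentum β U μ K e₀ n j ?_
        simp only [Fin.sum_univ_two, Matrix.cons_val_zero, Matrix.cons_val_one, Fin.isValue, if_true, one_ne_zero, if_false,
          one_smul, neg_smul]
        intro h0
        apply hj
        linear_combination -h0
      · refine kernel_klEffectiveAction_eq_zero_of_freq β U μ K e₀ n ?_
        simp only [Fin.sum_univ_two, Matrix.cons_val_zero, Matrix.cons_val_one, Fin.isValue, if_true, one_ne_zero, if_false,
          one_mul, neg_mul]
        intro h0
        apply hf
        apply matsubaraInt_injective M
        linarith
    · refine kernel_klEffectiveAction_eq_zero_of_spin β U μ K e₀ n ?_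
      fin_cases σ <;> fin_cases σ' <;> simp_all [Fin.sum_univ_two]
  · obtain rfl : c' = 0 := by
      rcases Fin.exists_fin_two.mp ⟨c', rfl⟩ with h | h
      · exact h
      · exact absurd h hc
    refine kernel_klEffectiveAction_eq_zero_of_charge β U μ K e₀ n ?_
    simp [Fin.sum_univ_two]

/-- … and (`ψ̂⁻` first): `kernel 𝒱_n 2 (ψ̂⁻_{pσ}, Y′) = 0` unless `Y′ = ψ̂⁺_{pσ}`. -/
theorem kernel_klEffectiveAction_two_minus_eq_zero (n : ℕ) (p : FreqMomentum L M) (σ : Fin 2) {Y' : HubbardFieldIdx L M}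
    (hY : Y' ≠ ((p, σ), 0)) : kernel ℂ (klEffectiveAction L M β U μ K e₀ n) 2 ![((p, σ), 1), Y'] = 0 := by
  rcases Y' with ⟨⟨p', σ'⟩, c'⟩
  by_cases hc : c' = 0
  · subst hc
    have h2 : (![((p', σ'), (0 : Fin 2)), ((p, σ), 1)] : Fin 2 → HubbardFieldIdx L M) = ![((p, σ), 1), ((p', σ'), 0)] ∘ Equiv.swap (0 : Fin 2) 1 := by
      funext i; fin_cases i <;> rfl
    have h := kernel_klEffectiveAction_two_plus_eq_zero β U μ K e₀ n p' σ' (Y' := ((p, σ), 1)) (fun h => hY (by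
      simp only [Prod.mk.injEq] at h
      rw [h.1.1, h.1.2]))
    rw [h2, kernel_comp_perm, Equiv.Perm.sign_swap (by decide)] at h
    simpa using h
  · obtain rfl : c' = 1 := by
      rcases Fin.exists_fin_two.mp ⟨c', rfl⟩ with h | h
      · exact absurd h hc
      · exact h
    refine kernel_klEffectiveAction_eq_zero_of_charge β U μ K e₀ n ?_
    simp [Fin.sum_univ_two]

/-! ## §3 The exact leg-dressing identity on the plain carriers -/

omit [NeZero M] in
/-- The scale-`n` action `𝒱_n` is even, at any reference energy `e₀` (p1's `klw_effectiveAction_mem_evenOdd_zero` is the case `e₀ = klE0`). -/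
theorem klEffectiveAction_mem_evenOdd_zero (n : ℕ) : klEffectiveAction L M β U μ K e₀ n ∈ evenOdd ℂ 0 := by
  rw [klEffectiveAction, hubbardEffectiveActionCT]
  exact effAction_mem_evenOdd_zero ℂ _ (hubbardInteractionCT_mem_evenOdd_zero L M β U K)
    (constPart_hubbardInteractionCT L M β U K)

/-- **`vertexFn_dblFold_oneLine_effectiveAction` — external-leg dressing on the PLAIN carriers, exactly.**  For `𝒱_n = klEffectiveAction … e₀ n`,
any diagonal line `C` (values `ℓ`) and ANY four external legs `Z`:
`𝒱₄(dblFold(Δ_×(C)(𝒱_n⁰·𝒱_n¹)))(Z) = 2·(βL²)⁻¹·𝒱₄(𝒱_n)(Z)·Σ_{i<4} ℓ(p_i)·klSelfEnergy … e₀ n (p_i) σ_i`. -/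
theorem vertexFn_dblFold_oneLine_effectiveAction (hβ : β ≠ 0) {C : Matrix (HubbardFieldIdx L M) (HubbardFieldIdx L M) ℂ}
    {ℓ : FreqMomentum L M → ℂ} (hC : contr ℂ C = diagContr L M ℓ) (n : ℕ) (Z : Fin 4 → HubbardFieldIdx L M) :
    vertexFn L M β (dblFold ℂ (grassmannLaplacian ℂ (crossCov ℂ C)
        (dblCopy ℂ 0 (klEffectiveAction L M β U μ K e₀ n) * dblCopy ℂ 1 (klEffectiveAction L M β U μ K e₀ n)))) 4 Z =
      2 * (((β * (L : ℝ) ^ 2 : ℝ) : ℂ))⁻¹ * vertexFn L M β (klEffectiveAction L M β U μ K e₀ n) 4 Z *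
        ∑ i : Fin 4, ℓ (Z i).1.1 * klSelfEnergy L M β U μ K e₀ n (Z i).1.1 (Z i).1.2 :=
  vertexFn_dblFold_oneLine_of_twoLeg β hβ hC _ (klEffectiveAction_mem_evenOdd_zero β U μ K e₀ n)
    (fun p σ _ hY => kernel_klEffectiveAction_two_plus_eq_zero β U μ K e₀ n p σ hY)
    (fun p σ _ hY => kernel_klEffectiveAction_two_minus_eq_zero β U μ K e₀ n p σ hY) Z

/-- **Norm form on the plain carriers** (`β > 0`):
`‖𝒱₄(dblFold(Δ_×(C)(𝒱_n⁰𝒱_n¹)))(Z)‖ ≤ 2(βL²)⁻¹·‖𝒱₄(𝒱_n)(Z)‖·Σ_i ‖ℓ(p_i)‖·‖klSelfEnergy … e₀ n (p_i) σ_i‖`. -/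
theorem norm_vertexFn_dblFold_oneLine_effectiveAction_le (hβ : 0 < β) {C : Matrix (HubbardFieldIdx L M) (HubbardFieldIdx L M) ℂ}
    {ℓ : FreqMomentum L M → ℂ} (hC : contr ℂ C = diagContr L M ℓ) (n : ℕ) (Z : Fin 4 → HubbardFieldIdx L M) :
    ‖vertexFn L M β (dblFold ℂ (grassmannLaplacian ℂ (crossCov ℂ C)
        (dblCopy ℂ 0 (klEffectiveAction L M β U μ K e₀ n) * dblCopy ℂ 1 (klEffectiveAction L M β U μ K e₀ n)))) 4 Z‖ ≤
      2 * (β * (L : ℝ) ^ 2)⁻¹ * ‖vertexFn L M β (klEffectiveAction L M β U μ K e₀ n) 4 Z‖ *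
        ∑ i : Fin 4, ‖ℓ (Z i).1.1‖ * ‖klSelfEnergy L M β U μ K e₀ n (Z i).1.1 (Z i).1.2‖ :=
  norm_vertexFn_dblFold_oneLine_of_twoLeg_le β hβ hC _ (klEffectiveAction_mem_evenOdd_zero β U μ K e₀ n)
    (fun p σ _ hY => kernel_klEffectiveAction_two_plus_eq_zero β U μ K e₀ n p σ hY)
    (fun p σ _ hY => kernel_klEffectiveAction_two_minus_eq_zero β U μ K e₀ n p σ hY) Z

end Model

end Summit.HubbardSuperconductivity.HubbardSuperconductivity.Theorems.KLRegimeWick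

end
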